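import Summits.NavierStokesRegularity.FluidComputer.PalasekTowerGermHostRate
import Summits.NavierStokesRegularity.FluidComputer.PalasekTowerGermHostAmplifier
import Summits.NavierStokesRegularity.FluidComputer.PalasekTowerTinyBlobStrainExplicit

/-!
# The germ host, XXV: the amplifier rule with NUMERIC carrier scale and NUMERIC budget

Cell `ns-blowup`, seat `ns-blowup-ecbridge-3` (g5); GROUP C «BRIDGE SUPPORT» of the route
`PalasekTowerBreakdown` (crux `EpisodeBaseG`, item stmt-NavierStokesRegularity-19179, R2). Sequel of
`PalasekTowerGermHostRate.lean` (`anchor_strictTinyProfile_ge`: slot rate `≥ Y₀³/200000`),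
`PalasekTowerTinyBlobStrainExplicit.lean` (`levelZeroData_strictTinyProfile_of_le`: carrier scale `0 < a ≤ 11/648`)
and `PalasekTowerGermHostAmplifier.lean` / `…CompanionFar.lean` (ecbridge-3 g4: `LevelZeroData.add_translate`, the
energy × `d⁻⁴` companion rule). LABEL: E–C typing (KERNEL, proofs only). WHAT THIS IS NOT: not Navier–Stokes
evidence — level-`0` bookkeeping of PRESCRIBED composite profiles at one instant; nothing about any flow after `τ₀`,
`FirstEpisodeD`, `RungG 1` or blow-up.

## What

g4's amplifier theorem `levelZeroData_strictTiny_add_translate` placed ANY amplifier `W'(· − c)` beyond the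
threshold `8 + R + max(1/N₀, 1 + 3Y₀∫‖W'‖²/(2π·rate⋆))` with `rate⋆ = levelZeroData_named.rate` and the carrier
scale `a⋆ = strictTinyScale` — two `Classical.choose` constants. Here both are numbers:

* `LevelZeroData.strictTinyProfile_add_translate` — any strict-slot certificate of `strictTinyProfile a`
  (`0 < a ≤ 5/256`, radius `ρ₁`) + amplifier at `1/N₀ ≤ d`, `ρ₁ + d + R < ‖c‖`, budget
  `(3/(2πd⁴)) Y₀ ∫‖W'‖² < Y₀³/200000`;
* **`levelZeroData_strictTinyProfile_add_translate_of_le`** — `0 < a ≤ 11/648`, `7 + d + R < ‖c‖`, same budget: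
  `LevelZeroData (strictTinyProfile a + W'(· − c)) (‖c‖ + R)` with NO `Classical.choose` constant in the hypotheses;
  host preparation and the crux reduction for these designs (`hostPreparationD_amplifier_of_le`,
  `episodeBaseG_of_firstEpisodeD_amplifier_of_le`).

Example (bus arithmetic, not a theorem): an amplifier of speed `≤ 0.9Y₀` in a ball of radius `0.3`
(`∫‖W'‖² ≤ 0.092·Y₀²`) passes the budget once `d⁴ > 3·0.092·200000/(2π) ≈ 8.8·10³`, i.e. `d ≳ 9.7`
(vs. the true rate `≈ 4.3·10⁻⁵Y₀³`: `d ≳ 5.7`).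

References: S. Palasek, arXiv:2605.13827 §3.3 [cite: Palasek2026ElementaryModel, §3.3]; D. Gilbarg, N. S. Trudinger,
*Elliptic PDE of Second Order* (2001), Lemma 4.1 [cite: GilbargTrudinger2001, Lemma 4.1].
-/

noncomputable section

namespace Summit.NavierStokesRegularity.FluidComputer.PalasekTowerClayBridge.Germ

open Set Function Filter Topology InnerProductSpace Metric MeasureTheory Real
open scoped Topology ContDiff RealInnerProductSpace

open Literature.Analysis.FluidPDE TinyBlob

section Amplifier

variable {a : ℝ}

/-- **THE AMPLIFIER RULE WITH A NUMERIC BUDGET.** A strict-slot certificate of `strictTinyProfile a`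
(`0 < a ≤ 5/256`, radius `ρ₁`) plus ANY amplifier `W'(· − c)` — `W'` smooth, divergence free,
`tsupport W' ⊆ B̄(0, R)`, `R ≥ 0`, speed `< Y₀` — at distance `1/N₀ ≤ d`, `ρ₁ + d + R < ‖c‖`, under the EXPLICIT
budget `(3/(2πd⁴)) Y₀ ∫‖W'‖² < Y₀³/200000`, fills the strict slot with radius `‖c‖ + R`.
[cite: Palasek2026ElementaryModel, §3.3] -/
theorem LevelZeroData.strictTinyProfile_add_translate {ρ₁ : ℝ} (h₁ : LevelZeroData (strictTinyProfile a) ρ₁)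
    (ha : 0 < a) (h5 : a ≤ 5 / 256)
    {W' : EuclideanSpace ℝ (Fin 3) → EuclideanSpace ℝ (Fin 3)} {R d : ℝ} {c : EuclideanSpace ℝ (Fin 3)}
    (hW : ContDiff ℝ ∞ W') (hdivW : VectorCalculus.IsDivFree W') (hWsupp : tsupport W' ⊆ closedBall 0 R)
    (hWlt : ∀ x, ‖W' x‖ < TowerRates.wide.Y 0) (hR : 0 ≤ R) (hdN : 1 / TowerRates.wide.N 0 ≤ d)
    (hc : ρ₁ + d + R < ‖c‖)
    (hbudget : 3 / (2 * π * d ^ 4) * TowerRates.wide.Y 0 * ∫ x, ‖W' x‖ ^ 2 < TowerRates.wide.Y 0 ^ 3 / 200000) :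
    LevelZeroData (strictTinyProfile a + fun x => W' (x - c)) (‖c‖ + R) :=
  h₁.add_translate hW hdivW hWsupp hWlt hR hdN hc (fun x hx => anchor_strictTinyProfile_ge ha h5 x hx) hbudget

/-- **FULLY NUMERIC AMPLIFIER HOSTS**: for every numeric carrier scale `0 < a ≤ 11/648`
(`levelZeroData_strictTinyProfile_of_le`, radius `7`), every amplifier `W'` as above and every centre `c` with
`7 + d + R < ‖c‖`, `1/N₀ ≤ d`, `(3/(2πd⁴)) Y₀ ∫‖W'‖² < Y₀³/200000`:
`LevelZeroData (strictTinyProfile a + W'(· − c)) (‖c‖ + R)` — no `Classical.choose` constant anywhere in the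
hypotheses. [cite: Palasek2026ElementaryModel, §3.3] -/
theorem levelZeroData_strictTinyProfile_add_translate_of_le (ha : 0 < a) (h : a ≤ 11 / 648)
    {W' : EuclideanSpace ℝ (Fin 3) → EuclideanSpace ℝ (Fin 3)} {R d : ℝ} {c : EuclideanSpace ℝ (Fin 3)}
    (hW : ContDiff ℝ ∞ W') (hdivW : VectorCalculus.IsDivFree W') (hWsupp : tsupport W' ⊆ closedBall 0 R)
    (hWlt : ∀ x, ‖W' x‖ < TowerRates.wide.Y 0) (hR : 0 ≤ R) (hdN : 1 / TowerRates.wide.N 0 ≤ d)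
    (hc : 7 + d + R < ‖c‖)
    (hbudget : 3 / (2 * π * d ^ 4) * TowerRates.wide.Y 0 * ∫ x, ‖W' x‖ ^ 2 < TowerRates.wide.Y 0 ^ 3 / 200000) :
    LevelZeroData (strictTinyProfile a + fun x => W' (x - c)) (‖c‖ + R) :=
  (levelZeroData_strictTinyProfile_of_le ha h).strictTinyProfile_add_translate ha (h.trans (by norm_num)) hW
    hdivW hWsupp hWlt hR hdN hc hbudget

/-- **Host preparation for the numeric amplifier designs**: the germ schedule of
`strictTinyProfile a + W'(· − c)` (hypotheses of `levelZeroData_strictTinyProfile_add_translate_of_le`) is prepared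
in its singleton class for every push constant `c₄ ∈ (0, 1]`. [cite: Palasek2026ElementaryModel, §3.3] -/
theorem hostPreparationD_amplifier_of_le (ha : 0 < a) (h : a ≤ 11 / 648)
    {W' : EuclideanSpace ℝ (Fin 3) → EuclideanSpace ℝ (Fin 3)} {R d : ℝ} {c : EuclideanSpace ℝ (Fin 3)}
    (hW : ContDiff ℝ ∞ W') (hdivW : VectorCalculus.IsDivFree W') (hWsupp : tsupport W' ⊆ closedBall 0 R)
    (hWlt : ∀ x, ‖W' x‖ < TowerRates.wide.Y 0) (hR : 0 ≤ R) (hdN : 1 / TowerRates.wide.N 0 ≤ d)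
    (hc : 7 + d + R < ‖c‖)
    (hbudget : 3 / (2 * π * d ^ 4) * TowerRates.wide.Y 0 * ∫ x, ‖W' x‖ ^ 2 < TowerRates.wide.Y 0 ^ 3 / 200000)
    {c₄ : ℝ} (hc₄ : 0 < c₄) (hc₄' : c₄ ≤ 1) :
    HostPreparationD (HostClass.exact
      ((levelZeroData_strictTinyProfile_add_translate_of_le ha h hW hdivW hWsupp hWlt hR hdN hc hbudget).schedule
        c₄ hc₄ hc₄')) :=
  (levelZeroData_strictTinyProfile_add_translate_of_le ha h hW hdivW hWsupp hWlt hR hdN hc hbudget).hostPreparationD_exact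
    hc₄ hc₄'

/-- **… and the crux for each numeric amplifier design is its episode.** [cite: Palasek2026ElementaryModel, §4] -/
theorem episodeBaseG_of_firstEpisodeD_amplifier_of_le (ha : 0 < a) (h : a ≤ 11 / 648)
    {W' : EuclideanSpace ℝ (Fin 3) → EuclideanSpace ℝ (Fin 3)} {R d : ℝ} {c : EuclideanSpace ℝ (Fin 3)}
    (hW : ContDiff ℝ ∞ W') (hdivW : VectorCalculus.IsDivFree W') (hWsupp : tsupport W' ⊆ closedBall 0 R)
    (hWlt : ∀ x, ‖W' x‖ < TowerRates.wide.Y 0) (hR : 0 ≤ R) (hdN : 1 / TowerRates.wide.N 0 ≤ d)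
    (hc : 7 + d + R < ‖c‖)
    (hbudget : 3 / (2 * π * d ^ 4) * TowerRates.wide.Y 0 * ∫ x, ‖W' x‖ ^ 2 < TowerRates.wide.Y 0 ^ 3 / 200000)
    {c₄ : ℝ} (hc₄ : 0 < c₄) (hc₄' : c₄ ≤ 1)
    (hF : FirstEpisodeD (HostClass.exact
      ((levelZeroData_strictTinyProfile_add_translate_of_le ha h hW hdivW hWsupp hWlt hR hdN hc hbudget).schedule
        c₄ hc₄ hc₄'))) :
    EpisodeBaseG :=
  (levelZeroData_strictTinyProfile_add_translate_of_le ha h hW hdivW hWsupp hWlt hR hdN hc hbudget).episodeBaseG_of_firstEpisodeD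
    hc₄ hc₄' hF

end Amplifier

end Summit.NavierStokesRegularity.FluidComputer.PalasekTowerClayBridge.Germ

end
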